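import Mathlib.FieldTheory.Galois.IsGaloisGroup
import Mathlib.NumberTheory.NumberField.Basic
import Mathlib.RingTheory.Frobenius
import Mathlib.RingTheory.Localization.AsSubring
import Mathlib.RingTheory.Ideal.Norm.AbsNorm
import Mathlib.RingTheory.DedekindDomain.IntegralClosure
import Mathlib.RingTheory.DedekindDomain.Ideal.Lemmas
import Mathlib.RingTheory.Ideal.Quotient.HasFiniteQuotients
import Mathlib.Algebra.CharP.Basic
import Mathlib.Data.ZMod.QuotientRing
import Mathlib.LinearAlgebra.FreeModule.IdealQuotient
import HarnessLib

/-!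
# Deuring's congruence argument: the Kronecker dichotomy modulo a Frobenius prime

Topic `NumberTheory/EllipticCurves` (complex multiplication); a proofs-only file (theorems only,
no definitions, no named facts) isolating the piece of algebraic number theory in Deuring's proof
of the "First Main Theorem" of complex multiplication as presented by Cox, *Primes of the form
x² + ny²*, §11.D, proof of Thm. 11.1, (11.30)–(11.33): if `j, j'` are algebraic numbers with
`Φ_p(j', j) = 0` for the modular equation `Φ_p`, then Kronecker's congruence
`Φ_p(X, Y) ≡ (X^p − Y)(X − Y^p) mod p` (Cox, Thm. 11.18(v)) gives, modulo a prime `𝔓 ∣ p`,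
"`j'^p ≡ j` or `j' ≡ j^p`" (Cox (11.32)), and comparison with the Frobenius automorphism at `𝔓`
turns the congruence into an *equality* `j' = σ(j)` or `j = σ(j')` as soon as `p` avoids the
finitely many primes modulo which the relevant (finitely many) algebraic numbers collide (Cox's
`Δ` of (11.31): "If `𝔞` and `𝔞'` lay in distinct ideal classes … `p` and `Δ` would not be
relatively prime").

We state it for an arbitrary number field `K`, Galois over `ℚ`, a finite `Gal(K/ℚ)`-stable set
`T ⊆ K`, and an arbitrary `F ∈ ℤ[Y][X]` whose reduction mod `p` is `(X^p − Y)(X − Y^p)`: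

* `exists_kronecker_dichotomy_modulus` — **main result**: there is `N ≠ 0` such that for every
  prime `p ∤ N`, every such `F`, and all `t, t' ∈ T` with `F(t', t) = 0`, there is
  `σ ∈ Gal(K/ℚ)` with `t' = σ t` or `t = σ t'`.

Ingredients (all Mathlib): a common denominator `d` with `d·T ⊆ 𝓞_K`
(`exists_integral_multiples`); `N = |d| · ∏_{t ≠ t'} |N_{K/ℚ}(dt − dt')|`; a maximal ideal
`𝔓` of `𝓞_K` above `p` (`Ideal.exists_ideal_over_maximal_of_isIntegral`); a Frobenius element
`σ`, `σ x ≡ x^p mod 𝔓` on `𝓞_K` (`IsArithFrobAt.exists_of_isInvariant`); the localisation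
`𝓞_K[1/d] ⊆ K` (`Localization.subalgebra.ofField`) and its reduction map to the residue field
`𝓞_K/𝔓` (`IsLocalization.lift`), which carries `F(t', t) = 0` to `(x'^p − x)(x' − x^p) = 0`
(`eval_map_map_eq_of_map_eq_kronecker`), is injective on `T` for `p ∤ N`
(`natPrime_dvd_norm_of_mem`: `x ∈ 𝔓 ⟹ p ∣ N(x)`) and intertwines `σ` with `x ↦ x^p`.
No integrality of the elements of `T` is needed (denominators prime to `p` are inverted).

This is the input, for `F = Φ_p` (`intModularPolynomial p`, `kronecker_congruence_int` of
`ModularPolynomialIntegral.lean`), of the transitivity argument for singular moduli in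
`SingularModuliRational.lean`.

## Mathlib / tree search

`lean search` for `IsArithFrobAt`, `exists_of_isInvariant`, `ofField`, `absNorm_dvd_norm_of_mem`:
Mathlib has all the pieces (used as listed); the tree uses `IsArithFrobAt.exists_of_isInvariant`
in `GaloisRepresentations/DegreeOnePrimesFixedField.lean` and `FrobeniusDensityTheorem.lean`
(templates for the number-field set-up); no existing statement of the dichotomy.

## References

* [Cox2013] D. A. Cox, *Primes of the form x² + ny²*, 2nd ed., Wiley 2013, §11.C Thm. 11.18(v)
  (Kronecker's congruence) and §11.D, proof of Thm. 11.1 ("We will follow the proof given by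
  Deuring in [24, §10]"), (11.30)–(11.33), PDF pp. 245–248 of the held copy.
* M. Deuring, *Die Klassenkörper der komplexen Multiplikation*, Enzyklopädie Math. Wiss. I.2,
  Heft 10, Teil II, Teubner 1958, §10 (cited through Cox).
-/

noncomputable section

open Polynomial NumberField

namespace Literature.NumberTheory.EllipticCurves

/-! ### Two-variable evaluation of `F ∈ ℤ[Y][X]` -/

/-- Transport of the evaluation `F(x, y)` of `F ∈ ℤ[Y][X]` (outer variable `X`, inner `Y`, the
convention of `intModularPolynomial`) along a ring homomorphism `g`: `g(F(x, y)) = F(g x, g y)`.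
[folklore] -/
theorem map_eval_map_map_int {B B' : Type*} [CommRing B] [CommRing B'] (g : B →+* B')
    (F : Polynomial (Polynomial ℤ)) (x y : B) :
    g (((F.map (mapRingHom (Int.castRingHom B))).map (evalRingHom y)).eval x) =
      ((F.map (mapRingHom (Int.castRingHom B'))).map (evalRingHom (g y))).eval (g x) := by
  rw [Polynomial.map_map, Polynomial.map_map, eval_map, eval_map, hom_eval₂]
  congr 1
  refine Polynomial.ringHom_ext (fun a => ?_) ?_
  · simp
  · simp

/-- In a ring of characteristic `p`, a polynomial `F ∈ ℤ[Y][X]` whose reduction mod `p` is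
`(X^p − Y)(X − Y^p)` evaluates as `F(x, y) = (x^p − y)(x − y^p)` (Kronecker's congruence read
in the residue field; Cox (11.32)). [cite: Cox2013, §11.D proof of Thm. 11.1, (11.32)] -/
theorem eval_map_map_eq_of_map_eq_kronecker {k : Type*} [CommRing k] (p : ℕ) [CharP k p]
    {F : Polynomial (Polynomial ℤ)}
    (hF : F.map (mapRingHom (Int.castRingHom (ZMod p))) = (X ^ p - C X) * (X - C (X ^ p)))
    (x y : k) :
    ((F.map (mapRingHom (Int.castRingHom k))).map (evalRingHom y)).eval x =
      (x ^ p - y) * (x - y ^ p) := by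
  have hc : Int.castRingHom k = (ZMod.castHom (dvd_refl p) k).comp (Int.castRingHom (ZMod p)) :=
    RingHom.ext_int _ _
  have hF' : F.map (mapRingHom (Int.castRingHom k)) =
      (F.map (mapRingHom (Int.castRingHom (ZMod p)))).map
        (mapRingHom (ZMod.castHom (dvd_refl p) k)) := by
    rw [Polynomial.map_map, hc]
    congr 1
    refine Polynomial.ringHom_ext (fun a => ?_) ?_
    · simp
    · simp
  rw [hF', hF]
  simp [Polynomial.map_mul, Polynomial.map_sub]

/-! ### Primes dividing norms -/

variable {K : Type*} [Field K] [NumberField K]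

/-- If `x` lies in a proper ideal `𝔓` of `𝓞_K` containing the rational prime `p`, then
`p ∣ N_{K/ℚ}(x)` (`N(𝔓) = p^f`, `f ≥ 1`, divides `N(x)`). [folklore] -/
theorem natPrime_dvd_norm_of_mem {Q : Ideal (𝓞 K)} (hQ : Q ≠ ⊤) {p : ℕ} (hp : p.Prime)
    (hpQ : (p : 𝓞 K) ∈ Q) {x : 𝓞 K} (hx : x ∈ Q) : (p : ℤ) ∣ Algebra.norm ℤ x := by
  have h1 : (Ideal.absNorm Q : ℤ) ∣ Algebra.norm ℤ x := Ideal.absNorm_dvd_norm_of_mem hx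
  have h3 : Ideal.absNorm Q ∣ p ^ Module.finrank ℤ (𝓞 K) := by
    rw [← Ideal.absNorm_span_natCast]
    exact Ideal.absNorm_dvd_absNorm_of_le ((Ideal.span_singleton_le_iff_mem _).mpr hpQ)
  have h4 : Ideal.absNorm Q ≠ 1 := by rwa [Ne, Ideal.absNorm_eq_one_iff]
  obtain ⟨k, -, hk'⟩ := (Nat.dvd_prime_pow hp).mp h3
  have hk0 : k ≠ 0 := by
    rintro rfl
    rw [pow_zero] at hk'
    exact h4 hk'
  have h2 : (p : ℤ) ∣ (Ideal.absNorm Q : ℤ) := by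
    rw [hk']
    exact_mod_cast dvd_pow_self p hk0
  exact h2.trans h1

/-- The Galois action on `𝓞 K` is the restriction of the action on `K`. [folklore] -/
theorem algebraMap_galois_smul (σ : K ≃ₐ[ℚ] K) (x : 𝓞 K) :
    algebraMap (𝓞 K) K (σ • x) = σ (algebraMap (𝓞 K) K x) := rfl

/-! ### The dichotomy -/

/-- **Deuring's congruence argument** (Cox, §11.D, proof of Thm. 11.1, (11.30)–(11.33)).  Let
`K` be a number field, Galois over `ℚ`, and `T ⊆ K` a finite `Gal(K/ℚ)`-stable set.  There is
`N ≠ 0` such that: for every prime `p ∤ N`, every `F ∈ ℤ[Y][X]` with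
`F ≡ (X^p − Y)(X − Y^p) mod p` (Kronecker's congruence, Cox Thm. 11.18(v), holds for the modular
equation `Φ_p`), and all `t, t' ∈ T` with `F(t', t) = 0`, there is `σ ∈ Gal(K/ℚ)` with
`t' = σ(t)` or `t = σ(t')`.  Proof: choose `d` with `dT ⊆ 𝓞_K` and put
`N = |d|·∏_{t ≠ t'} |N(dt − dt')|`; for `p ∤ N` take a prime `𝔓 ∣ p` of `𝓞_K` and a Frobenius
`σ` at `𝔓`; reduce `𝓞_K[1/d] → 𝓞_K/𝔓 = k` (possible as `p ∤ d`): the reduction `x ↦ x̄` is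
injective on `T` (if `x̄ = x̄'` then `p ∣ N(dx − dx')`), satisfies `σ(x)‾ = x̄^p`, and
`F(t', t) = 0` becomes `(t̄'^p − t̄)(t̄' − t̄^p) = 0` in the field `k` (Cox (11.32)); if
`t̄' = t̄^p = σ(t)‾` then `t' = σ(t)`, and if `t̄ = t̄'^p = σ(t')‾` then `t = σ(t')`.
[cite: Cox2013, §11.D proof of Thm. 11.1, (11.30)–(11.33)] -/
theorem exists_kronecker_dichotomy_modulus [IsGalois ℚ K] (T : Finset K)
    (hT : ∀ σ : K ≃ₐ[ℚ] K, ∀ t ∈ T, σ t ∈ T) :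
    ∃ N : ℕ, N ≠ 0 ∧ ∀ p : ℕ, p.Prime → ¬ p ∣ N → ∀ F : Polynomial (Polynomial ℤ),
      F.map (mapRingHom (Int.castRingHom (ZMod p))) = (X ^ p - C X) * (X - C (X ^ p)) →
      ∀ t ∈ T, ∀ t' ∈ T,
        ((F.map (mapRingHom (Int.castRingHom K))).map (evalRingHom t)).eval t' = 0 →
        ∃ σ : K ≃ₐ[ℚ] K, t' = σ t ∨ t = σ t' := by
  classical
  -- Step 1: a common denominator `d` and the integral multiples `u t = d t ∈ 𝓞 K`
  obtain ⟨d, hd0, hdint⟩ := exists_integral_multiples ℤ ℚ T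
  have hmem : ∀ t ∈ T, IsIntegral ℤ ((d : K) * t) := fun t ht => by
    rw [← zsmul_eq_mul]
    exact hdint t ht
  let u : K → 𝓞 K := fun t => if ht : t ∈ T then ⟨(d : K) * t, hmem t ht⟩ else 0
  have hu : ∀ t ∈ T, algebraMap (𝓞 K) K (u t) = d * t := fun t ht => by
    simp only [u, dif_pos ht, RingOfIntegers.map_mk]
  have hdK : (d : K) ≠ 0 := Int.cast_ne_zero.mpr hd0
  have hdcoe : algebraMap (𝓞 K) K (d : 𝓞 K) = (d : K) := map_intCast _ d
  have hu_inj : ∀ t ∈ T, ∀ t' ∈ T, u t = u t' → t = t' := fun t ht t' ht' h => by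
    have h' := congrArg (algebraMap (𝓞 K) K) h
    rw [hu t ht, hu t' ht'] at h'
    exact mul_left_cancel₀ hdK h'
  -- Step 2: the modulus `N = |d| · ∏_{t ≠ t'} |N(u t - u t')|`
  let N₁ : ℕ := ∏ x ∈ (T ×ˢ T).filter (fun x => x.1 ≠ x.2), (Algebra.norm ℤ (u x.1 - u x.2)).natAbs
  have hN₁ : N₁ ≠ 0 := by
    refine Finset.prod_ne_zero_iff.mpr ?_
    rintro ⟨t, t'⟩ hx
    simp only [Finset.mem_filter, Finset.mem_product] at hx
    rw [Ne, Int.natAbs_eq_zero, Algebra.norm_eq_zero_iff, sub_eq_zero]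
    exact fun h => hx.2 (hu_inj t hx.1.1 t' hx.1.2 h)
  have hN₁dvd : ∀ t ∈ T, ∀ t' ∈ T, t ≠ t' →
      ((Algebra.norm ℤ (u t - u t')).natAbs : ℕ) ∣ N₁ := by
    intro t ht t' ht' hne
    have hmemx : (t, t') ∈ (T ×ˢ T).filter (fun x => x.1 ≠ x.2) :=
      Finset.mem_filter.mpr ⟨Finset.mem_product.mpr ⟨ht, ht'⟩, hne⟩
    have h := Finset.dvd_prod_of_mem (fun x : K × K => (Algebra.norm ℤ (u x.1 - u x.2)).natAbs) hmemx
    exact h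
  refine ⟨d.natAbs * N₁, mul_ne_zero (Int.natAbs_ne_zero.mpr hd0) hN₁, ?_⟩
  intro p hp hpN F hF t ht t' ht' hev
  have hpd : ¬ (p : ℤ) ∣ d := fun h => hpN (dvd_mul_of_dvd_left (Int.ofNat_dvd_left.mp h) _)
  have hpN₁ : ¬ p ∣ N₁ := fun h => hpN (dvd_mul_of_dvd_right h _)
  -- Step 3: a maximal ideal `Q` of `𝓞 K` above `p`; its finite residue field has characteristic `p`
  haveI : Fact p.Prime := ⟨hp⟩
  haveI hpmax : (Ideal.span {(p : ℤ)}).IsMaximal :=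
    PrincipalIdealRing.isMaximal_of_irreducible (Nat.prime_iff_prime_int.mp hp).irreducible
  obtain ⟨Q, hQmax, hQcomap⟩ := Ideal.exists_ideal_over_maximal_of_isIntegral
    (S := 𝓞 K) (Ideal.span {(p : ℤ)}) (fun x hx => by
      rw [RingHom.mem_ker] at hx
      have : x = 0 := (algebraMap ℤ (𝓞 K)).injective_int (by rw [hx, map_zero])
      simp [this])
  have hQp : (p : 𝓞 K) ∈ Q := by
    have : algebraMap ℤ (𝓞 K) p ∈ Q := by
      rw [← Ideal.mem_comap, hQcomap]
      exact Ideal.mem_span_singleton_self _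
    simpa using this
  have hQtop : Q ≠ ⊤ := hQmax.ne_top
  have hQbot : Q ≠ ⊥ := fun h => by
    rw [h, Ideal.mem_bot] at hQp
    exact hp.ne_zero (by exact_mod_cast hQp)
  haveI : Q.IsMaximal := hQmax
  haveI : Finite (𝓞 K ⧸ Q) := Ideal.finiteQuotientOfFreeOfNeBot Q hQbot
  letI : Field (𝓞 K ⧸ Q) := Ideal.Quotient.field Q
  have hpk : ((p : ℕ) : 𝓞 K ⧸ Q) = 0 := by
    rw [← map_natCast (Ideal.Quotient.mk Q), Ideal.Quotient.eq_zero_iff_mem]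
    exact hQp
  haveI : CharP (𝓞 K ⧸ Q) p := (CharP.charP_iff_prime_eq_zero hp).mpr hpk
  -- the reduction of `d` is nonzero
  have hdQ : (d : 𝓞 K) ∉ Q := fun h => hpd (by
    have h1 := natPrime_dvd_norm_of_mem hQtop hp hQp h
    rw [← eq_intCast (algebraMap ℤ (𝓞 K)) d, Algebra.norm_algebraMap] at h1
    exact (Nat.prime_iff_prime_int.mp hp).dvd_of_dvd_pow h1)
  have hdk : (Ideal.Quotient.mk Q (d : 𝓞 K)) ≠ 0 := by
    rwa [Ne, Ideal.Quotient.eq_zero_iff_mem]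
  -- Step 4: a Frobenius element `σ` at `Q`: `σ x ≡ x ^ p (mod Q)` on `𝓞 K`
  obtain ⟨σ, hσ⟩ := IsArithFrobAt.exists_of_isInvariant ℤ (K ≃ₐ[ℚ] K) Q
  have hcard : Nat.card (ℤ ⧸ Q.under ℤ) = p := by
    rw [Ideal.under_def, hQcomap, Nat.card_congr (Int.quotientSpanNatEquivZMod p).toEquiv,
      Nat.card_zmod]
  have hfrob : ∀ x : 𝓞 K,
      Ideal.Quotient.mk Q (σ • x) = (Ideal.Quotient.mk Q x) ^ p := fun x => by
    have h : _ - _ ∈ Q := hσ x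
    rw [hcard, MulSemiringAction.toAlgHom_apply, ← Ideal.Quotient.mk_eq_mk_iff_sub_mem] at h
    rw [h, map_pow]
  -- Step 5: the reduction map `φ` on `R = 𝓞 K[1/d] ⊆ K`
  have hd0' : (d : 𝓞 K) ≠ 0 := by exact_mod_cast hd0
  have hS : Submonoid.powers (d : 𝓞 K) ≤ nonZeroDivisors (𝓞 K) :=
    powers_le_nonZeroDivisors_of_noZeroDivisors hd0'
  set R : Subalgebra (𝓞 K) K := Localization.subalgebra.ofField K (Submonoid.powers (d : 𝓞 K)) hS
    with hR
  have hunit : ∀ y : Submonoid.powers (d : 𝓞 K), IsUnit (Ideal.Quotient.mk Q (y : 𝓞 K)) := by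
    rintro ⟨y, n, rfl⟩
    rw [map_pow]
    exact (isUnit_iff_ne_zero.mpr hdk).pow n
  let φ : R →+* 𝓞 K ⧸ Q := IsLocalization.lift (M := Submonoid.powers (d : 𝓞 K)) hunit
  have hφalg : ∀ a : 𝓞 K, φ (algebraMap (𝓞 K) R a) = Ideal.Quotient.mk Q a := fun a =>
    IsLocalization.lift_eq hunit a
  -- the elements `a / d`, `a ∈ 𝓞 K`, of `R`; among them the elements of `T`
  have hmemR : ∀ a : 𝓞 K, algebraMap (𝓞 K) K a * (d : K)⁻¹ ∈ R := fun a =>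
    ⟨a, (d : 𝓞 K), Submonoid.mem_powers _, by rw [hdcoe]⟩
  have hdiv : ∀ s ∈ T, (s : K) = algebraMap (𝓞 K) K (u s) * (d : K)⁻¹ := fun s hs => by
    rw [hu s hs, mul_comm ((d : K)) s, mul_assoc, mul_inv_cancel₀ hdK, mul_one]
  have htR : ∀ s ∈ T, (s : K) ∈ R := fun s hs => by
    rw [hdiv s hs]
    exact hmemR (u s)
  -- value of `φ` on `a / d`
  have hφval : ∀ (a : 𝓞 K) (z : R), (z : K) = algebraMap (𝓞 K) K a * (d : K)⁻¹ →
      φ z * Ideal.Quotient.mk Q (d : 𝓞 K) = Ideal.Quotient.mk Q a := by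
    intro a z hz
    have hmul : z * algebraMap (𝓞 K) R d = algebraMap (𝓞 K) R a := by
      apply Subtype.ext
      rw [Subalgebra.coe_mul, Subalgebra.coe_algebraMap, Subalgebra.coe_algebraMap, hz, hdcoe,
        mul_assoc, inv_mul_cancel₀ hdK, mul_one]
    have := congrArg φ hmul
    rwa [map_mul, hφalg, hφalg] at this
  -- `φ` is injective on `T`
  have hφinj : ∀ s ∈ T, ∀ s' ∈ T, ∀ (hs : (s : K) ∈ R) (hs' : (s' : K) ∈ R),
      φ ⟨s, hs⟩ = φ ⟨s', hs'⟩ → s = s' := by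
    intro s hs s' hs' hsR hs'R h
    by_contra hne
    have h2 : Ideal.Quotient.mk Q (u s) = Ideal.Quotient.mk Q (u s') := by
      rw [← hφval (u s) ⟨s, hsR⟩ (hdiv s hs), ← hφval (u s') ⟨s', hs'R⟩ (hdiv s' hs'), h]
    rw [Ideal.Quotient.mk_eq_mk_iff_sub_mem] at h2
    have h3 := natPrime_dvd_norm_of_mem hQtop hp hQp h2
    have h4 : p ∣ (Algebra.norm ℤ (u s - u s')).natAbs := Int.ofNat_dvd_left.mp h3
    exact hpN₁ (h4.trans (hN₁dvd s hs s' hs' hne))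
  -- `φ` intertwines `σ` and the `p`-th power map on `T`
  have hφfrob : ∀ s ∈ T, ∀ (hs : (s : K) ∈ R) (hσs : ((σ s : K)) ∈ R),
      φ ⟨σ s, hσs⟩ = (φ ⟨s, hs⟩) ^ p := by
    intro s hs hsR hσsR
    have hσu : algebraMap (𝓞 K) K (σ • u s) = (d : K) * σ s := by
      rw [algebraMap_galois_smul, hu s hs, map_mul, map_intCast]
    have e1 : φ ⟨σ s, hσsR⟩ * Ideal.Quotient.mk Q (d : 𝓞 K) = Ideal.Quotient.mk Q (σ • u s) := by
      refine hφval (σ • u s) ⟨σ s, hσsR⟩ ?_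
      change (σ s : K) = algebraMap (𝓞 K) K (σ • u s) * (d : K)⁻¹
      rw [hσu, mul_comm ((d : K)), mul_assoc, mul_inv_cancel₀ hdK, mul_one]
    have e2 : φ ⟨s, hsR⟩ * Ideal.Quotient.mk Q (d : 𝓞 K) = Ideal.Quotient.mk Q (u s) :=
      hφval (u s) ⟨s, hsR⟩ (hdiv s hs)
    -- the reduction of `d` is fixed by the `p`-th power map
    have hdp : (Ideal.Quotient.mk Q (d : 𝓞 K)) ^ p = Ideal.Quotient.mk Q (d : 𝓞 K) := by
      rw [map_intCast, ← frobenius_def, map_intCast]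
    rw [hfrob, ← e2, mul_pow, hdp] at e1
    exact mul_right_cancel₀ hdk e1
  -- Step 6: Kronecker's congruence in the residue field
  have hσt : (σ t : K) ∈ R := htR _ (hT σ t ht)
  have hσt' : (σ t' : K) ∈ R := htR _ (hT σ t' ht')
  have hev' : ((F.map (mapRingHom (Int.castRingHom R))).map (evalRingHom ⟨t, htR t ht⟩)).eval
      ⟨t', htR t' ht'⟩ = 0 := by
    apply IsFractionRing.injective R K
    rw [map_eval_map_map_int (algebraMap R K) F, map_zero]
    exact hev
  have hk : ((φ ⟨t', htR t' ht'⟩) ^ p - φ ⟨t, htR t ht⟩) *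
      (φ ⟨t', htR t' ht'⟩ - (φ ⟨t, htR t ht⟩) ^ p) = 0 := by
    rw [← eval_map_map_eq_of_map_eq_kronecker p hF, ← map_eval_map_map_int φ F, hev', map_zero]
  -- Step 7: the dichotomy
  refine ⟨σ, ?_⟩
  rcases mul_eq_zero.mp hk with h | h
  · -- `x'^p = x`: `φ(σ t') = φ(t)`, so `σ t' = t`
    right
    rw [sub_eq_zero] at h
    have : φ ⟨σ t', hσt'⟩ = φ ⟨t, htR t ht⟩ := by rw [hφfrob t' ht' (htR t' ht') hσt', h]
    exact (hφinj _ (hT σ t' ht') _ ht hσt' (htR t ht) this).symm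
  · -- `x' = x^p`: `φ(t') = φ(σ t)`, so `t' = σ t`
    left
    rw [sub_eq_zero] at h
    have : φ ⟨t', htR t' ht'⟩ = φ ⟨σ t, hσt⟩ := by rw [hφfrob t ht (htR t ht) hσt, ← h]
    exact hφinj _ ht' _ (hT σ t ht) (htR t' ht') hσt this

end Literature.NumberTheory.EllipticCurves

end
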